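import Mathlib
import HarnessLib
import Literature.Analysis.FluidPDE.LagrangianLatticeCarrier
import Summits.AnomalousDissipation.AnomalousDissipation.Theses.SolenoidalFractalHomogenisation
import Summits.AnomalousDissipation.AnomalousDissipation.Theorems.SolenoidalFractalHomogenisationLagrangianCarrierConstructionBookkeepingL  -- v4: stub_bookkeepingL DISCHARGED by p611052
import Summits.AnomalousDissipation.AnomalousDissipation.Theorems.SolenoidalFractalHomogenisationLagrangianCarrierConstructionFlowsLRegular  -- v7: stub_flowsL by name (p622441)
-- v8 CANDIDATE (2026-08-28T1xZ, ideator planner ad-ideate-p4 g6, lens «control»; NOT registered — tenure's call): = v7 with `stub_regularL`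
--   RE-CUT to `∀ k W, ∃ θs > 0, ∀ E θ₀, E.design = W → θ₀ ≤ θs → <v7 binders verbatim> → E.Regular` (a design-dependent STRAIN-BUDGET CEILING θs);
--   the composition builds the bookkeeping at `min θ₀ θs` (stub_bookkeepingL is ∀ θ₀ > 0 and CLOSED, p611052) — zero cost to the crux, which keeps ∀ θ₀ > 0.
--   WHY: from the v7 binders the frame-distortion recursion d_m ≤ κ_k (1 + D_{m-1})^p θ_{m+1} (conjugation of the level-m Eulerian increment by the
--   level-(m-1) frame, p ∈ [2,6]) has the trapping region {D ≤ 1/2} only when κ_k θ_{m+1} (3/2)^p ≤ 1/2 for ALL m, i.e. θ₀ small; for κ_k θ₀ ≳ 1/2 at the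
--   minimal separation N_{m+1} = N_m², N_1 = 2 the a-priori recursion diverges double-exponentially (see Ideas/distortion-trapping-ceiling.md).
-- TREE VARIANT (post-rev-12): the crux decl is the route's; no LOCAL COPY.
-- v7 (2026-08-28T10:1xZ, planner ad-ideate-p1 g23): = v6 with stub_flowsL DISCHARGED BY NAME (p622441 exists_isLagrangian_levelRegular'); ONE open stub left: stub_regularL.

/-!
v6 (2026-08-28T09:5xZ, tenure planner ad-ideate-p1 g23; RE-CUT after the kernel-checked NEGATIVE `…Theorems.SolenoidalFractalHomogenisation.
LagrangianCarrierConstruction.stub_flowsL_false` (p620416, seat ad-k3l-bookkeeping-p1 g0; file `Theorems/LagrangianCarrierConstruction/Negative/StubFlowsLFalse.lean`):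
the v3–v5 text of `stub_flowsL` concluded `E'.LevelRegular`, whose clause (R0) (pointwise summability of the levels) is a property of the BOOKKEEPING
(amplitudes `a_m/N_m`), not of the insertion — witness: one-slot Kolmogorov word, `N = 45^m`, `a = 225^m`, `kbar = 9^{-m}` (Permissible, W1, W2;
`b = level`, `level (m+1) t₀ x₀ = 5^{m+1}/(2π) ê₂`). CLASS stub-misstated (crux untouched: the K3L statement asks `Regular` of the ACTUAL
construction, whose amplitudes decay). REPAIR (the prover's option (a)): `stub_flowsL` now delivers `E'.IsLagrangian` ∧ the ELEVEN qualitative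
per-level / per-flow clauses of `LevelRegular` OTHER THAN (R0) ((L1) (L2) (L3a) (L3b) (L4) (F1a) (F1b) (F1c) (F2a) (F2b) (F2c), verbatim texts);
`stub_regularL` takes those eleven clauses as separate binders in place of `E.LevelRegular` and still concludes `E.Regular` (so (R0) — with the
Hölder sum, periodicity and weak divergence-freeness of the carrier — is proved THERE, from the amplitude decay DEC, N²-separation and the
θ-template via the distortion tower, advisory R23-2). `stub_bookkeepingL` byte-identical (closed by name, p611052). Composition updated accordingly.

v5 (2026-08-28, tenure planner ad-ideate-p1 g23; STAGED — register ONLY after `LPermissible` amendment 2 (RULING R23-1 (C), finding F-g23-1) has LANDED):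
= v4 with the composition building `E.LPermissible` through the amended six-clause constructor `LPermissible.intro hP hLag hW1 hW2 hS hdec`
(the amplitude-decay clause (A) `∃ α₀ > 0, ∀ m, a (m+1) ≤ N (m+1) ^ (1 − α₀)` that the LANDED `stub_bookkeepingL` (p611052) already delivers as `hdec`
is now EXPORTED through `LPermissible` instead of being dropped). All three stub TEXTS byte-identical to v3/v4 (bookkeepingL credit carries;
flowsL / regularL provers unaffected). Before the amendment this file does NOT elaborate (`LPermissible.intro` unknown) — that is intended.

v4 (2026-08-28T07:2xZ, tenure planner ad-ideate-p1 g22): = v3 with `stub_bookkeepingL` DISCHARGED BY NAME from the landed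
`…Theorems.SolenoidalFractalHomogenisation.LagrangianCarrierConstruction.stub_bookkeepingL` (p611052, seat ad-k3l-bookkeeping-p1 g0 — by name + signature, stub credit 07:01:45Z).
Active stubs: flowsL, regularL (v3 signatures). Everything else byte-identical to v3.

v3 (2026-08-28T07:1xZ, tenure planner ad-ideate-p1 g22; RE-CUT per F-g5-2 of lead k2r-lowerlaw-p1 g5 after R22-1 / p610969): `stub_flowsL` now takes
(Permissible, W1, W2) and DELIVERS `E'.LevelRegular` for its own explicit witness; `stub_regularL` takes `E.LevelRegular` as an extra hypothesis (no abstract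
ODE bootstrap anywhere); `stub_bookkeepingL` byte-identical to v2 (seat ad-k3l-bookkeeping-p1 unaffected); composition shape unchanged.

# BC3 birth skeleton — crux `LagrangianCarrierConstruction` (K3L, route SolenoidalFractalHomogenisation rev 12)

Three registered stubs and the kernel-checked composition `LagrangianCarrierConstruction_of`:

* `stub_bookkeepingL` — the ARITHMETIC: Eulerian bookkeeping data (`N, a, kbar`) + refresh windows + strain budgets realising
  `Permissible` ∧ (W1) windows = whole fine periods ∧ (W2) nested windows ∧ (S) strain ≤ θ ∧ the super-geometric template
  (T1)–(T5) ∧ amplitude decay `a_(m+1) ≤ N_(m+1)^(1-α₀)` (fields `b`, `disp` junk). Recipe (ROUND-15 §G): `N (m+1) = N m ^ 2`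
  (`N 1` large), `cellVisc (m+1) ≈ λ_m · K · n^(-3/4)` fine-tuned so that `G_(m+1) = n²/R` with `R` a positive multiple of
  `r_(m+1) = ⌈n^(1/16)⌉` (P8 + W2), `a (m+1) = kbar m · N (m+1)² /(ν G)`, `kbar (m+1) = kbar m / G`, `θ (m+1) = θ₀ n^(-1/16)`,
  `refresh (m+1) = r_(m+1) · physPeriod (m+1)`; the strain clause reduces to `ν_m ν_(m+1)² ≥ (2Pc/θ₀) n^(-15/8)`, met by the
  bounded recursion `λ_(m+1) = max (1, √(C/(λ_m K³)))`; the joint scale of `(a, kbar)` is free, which buys the decay clause (α₀ < 1/8).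
  NUMERIC INSTANCE CHECK (ROUND-16 §I, F16-4, g17): with the FIELD definitions `cellVisc`, `physPeriod`, `strain` and the realised cubature
  gain `c ≈ 4.83e-6`, every clause of `Permissible` (9) + (W1)(W2)(S) + sep + (T1)–(T5) + DEC passes for `m ≤ 5` under three amendments:
  (i) `r_(m+1) = ⌊n^(1/16)⌋ + 1` (strict, for T5); (ii) level 1 ON THE GENERIC CURVE `cellVisc 1 = K · N 1^(-3/8)` (the bare λ-recursion
  under-provisions the first transition `m = 1`: strain S[1] and viscous domination P7[1,2] fail otherwise); (iii) `N 1 ≥ max (K^8,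
  (K/ν₀)^(8/3))`-large (T2[0], P5[1]) and `cellVisc (m+1) ≤ c` for `m ≥ 1` (P7 binding case `j = m`). Script: `r16/bookkeeping_check2.py`.
* `stub_flowsL` — the LAGRANGIAN INSERTION exists: for ANY carrier data there are level fields `b` and displacements `disp` over the
  same bookkeeping with `IsLagrangian` (the flows of the explicit piecewise shear fields exist globally and each level is the pushed-forward
  Eulerian lattice level, window by window; inside a slot the flow is `LatticePhase.shearMap`). No hypothesis needed: bounded, x-Lipschitz,
  t-measurable fields have global flows on 𝕋³, by induction on the level.
* `stub_regularL` — REGULARITY of the summed Lagrangian carrier from the bookkeeping: summable levels, `C⁰_t C^(0,α)_x` for every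
  `α < α₀` (pushforwards by flows with `‖DX − I‖ ≤ θ ≤ θ₀` keep Hölder seminorms up to `(1+θ₀)`, amplitudes `a/N ≤ N^(-α₀)`,
  `N (m+1) ≥ N m ^ 2`), time-continuity across window resets (W1: the ramped word vanishes at period boundaries), time-periodicity with
  period `refresh 1` (W1 + W2), weak divergence-freeness (pushforward of a div-free field by a volume-preserving C¹ flow).

Planner sketch (seat ad-ideate-p1 g16, 2026-08-27); `lean check`: sorries ONLY in the three stubs.
-/

namespace Summit.AnomalousDissipation.AnomalousDissipation.Cruxes.LagrangianCarrierConstruction.BirthV8Candidate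

open Summit.AnomalousDissipation.AnomalousDissipation.Theses.SolenoidalFractalHomogenisation (LagrangianCarrierConstruction)

/-- stub 1 (M/L): the super-geometric bookkeeping family — pure ℕ/ℝ arithmetic (recipe in the module docstring). -/
theorem stub_bookkeepingL : ∀ k (W : Literature.Analysis.FluidPDE.LatticeShear.LatticeWord k) (c ν₀ K θ₀ : ℝ) (Λ₀ : ℕ), 0 < c → 0 < ν₀ → 0 < K → 0 < θ₀ → ∃ E : Literature.Analysis.FluidPDE.LatticeShear.LagrangianLatticeCarrier k, E.design = W ∧ E.gain = c ∧ E.nu0 = ν₀ ∧ E.K = K ∧ E.toFractalCarrierData.Permissible ∧ (∀ m, ∃ r : ℕ, 0 < r ∧ E.refresh (m + 1) = (r : ℝ) * E.toFractalCarrierData.physPeriod (m + 1)) ∧ (∀ m, ∃ q : ℕ, 0 < q ∧ E.refresh m = (q : ℝ) * E.refresh (m + 1)) ∧ (∀ m, E.strain m ≤ E.θ (m + 1)) ∧ (∀ m, Λ₀ * E.N m ≤ E.N (m + 1)) ∧ (∀ m, E.N m ^ 2 ≤ E.N (m + 1)) ∧ (∀ m, E.cellVisc (m + 1) * ((E.N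 (m + 1) : ℝ) / E.N m) ^ (1 / 4 : ℝ) ≤ 1) ∧ (∀ m, E.K * ((E.N (m + 1) : ℝ) / E.N m) ^ (1 / 4 : ℝ) ≤ ((E.N (m + 1) : ℝ) / E.N m) * E.cellVisc (m + 1)) ∧ (∀ m, E.θ (m + 1) * ((E.N (m + 1) : ℝ) / E.N m) ^ (1 / 16 : ℝ) ≤ θ₀) ∧ (∀ m, ((E.N (m + 1) : ℝ) / E.N m) ^ (1 / 16 : ℝ) * E.physPeriod (m + 1) ≤ E.refresh (m + 1)) ∧ (∃ α₀ : ℝ, 0 < α₀ ∧ ∀ m, E.a (m + 1) ≤ ((E.N (m + 1) : ℝ)) ^ (1 - α₀)) :=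
  Summit.AnomalousDissipation.AnomalousDissipation.Theorems.SolenoidalFractalHomogenisation.LagrangianCarrierConstruction.stub_bookkeepingL

/-- stub 2 (M/L) — CLOSED BY NAME in v7 (`…LagrangianCarrierConstruction.exists_isLagrangian_levelRegular'`, p622441, seat ad-k3l-bookkeeping-p1 g0; the tree theorem does not even need `Permissible`): Lagrangian insertion — over permissible bookkeeping data with commensurable refresh windows (W1, W2), the explicit flows and
pushed-forward levels exist AND carry every QUALITATIVE per-level / per-flow clause of `LevelRegular` except the series clause (R0) (v6 re-cut after
`stub_flowsL_false`, p620416): (L1) joint continuity, (L2) weak divergence-freeness, (L3a/b) smoothness in `x` with `t`-uniform derivative bounds,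
(L4) time-periodicity, (F1a–c) continuity / smoothness / windowed derivative bounds of the displacements, (F2a–c) `X m s s = id`, group law,
volume preservation (explicit compositions of slot shear maps; W1 makes the levels continuous across window resets, commensurability periodic). -/
theorem stub_flowsL : ∀ k (E : Literature.Analysis.FluidPDE.LatticeShear.LagrangianLatticeCarrier k), E.toFractalCarrierData.Permissible → (∀ m, ∃ r : ℕ, 0 < r ∧ E.refresh (m + 1) = (r : ℝ) * E.toFractalCarrierData.physPeriod (m + 1)) → (∀ m, ∃ q : ℕ, 0 < q ∧ E.refresh m = (q : ℝ) * E.refresh (m + 1)) → ∃ E' : Literature.Analysis.FluidPDE.LatticeShear.LagrangianLatticeCarrier k, E'.toFractalCarrierData = E.toFractalCarrierData ∧ E'.refresh = E.refresh ∧ E'.θ = E.θ ∧ E'.IsLagrangian ∧ (∀ m, Continuous (Function.uncurry (E'.b (m + 1)))) ∧ (∀ m t, Literature.Analysis.FunctionSpaces.Torus.IsWeaklyDivFree (E'.b (m + 1) t)) ∧ (∀ m t, Literature.Analysis.FunctionSpaces.Torus.IsSmooth (E'.b (m + 1) t)) ∧ (∀ m (n : ℕ), ∃ C : ℝ, ∀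 t y, ‖iteratedFDeriv ℝ n (Literature.Analysis.FunctionSpaces.Torus.lift (E'.b (m + 1) t)) y‖ ≤ C) ∧ (∀ m, ∃ τ : ℝ, 0 < τ ∧ Function.Periodic (E'.b (m + 1)) τ) ∧ (∀ m s, Continuous fun p : ℝ × UnitAddTorus (Fin 3) => E'.disp m p.1 s p.2) ∧ (∀ m t s, Literature.Analysis.FunctionSpaces.Torus.IsSmooth (E'.disp m t s)) ∧ (∀ m (n : ℕ) (j : ℤ), ∃ C : ℝ, ∀ t ∈ E'.window (m + 1) j, ∀ y, ‖iteratedFDeriv ℝ n (Literature.Analysis.FunctionSpaces.Torus.lift (E'.disp m t ((j : ℝ) * E'.refresh (m + 1)))) y‖ ≤ C) ∧ (∀ m s, E'.X m s s = id) ∧ (∀ m t s r, E'.X m t s ∘ E'.X m s r = E'.X m t r) ∧ (∀ m t s, MeasureTheory.MeasurePreserving (E'.X m t s) MeasureTheory.volume MeasureTheory.volume) :=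
  fun k E _hP hW1 hW2 =>
    Summit.AnomalousDissipation.AnomalousDissipation.Theorems.SolenoidalFractalHomogenisation.LagrangianCarrierConstruction.exists_isLagrangian_levelRegular' k E hW1 hW2

/-- stub 3 (XL): regularity of the SUMMED carrier (`Regular` = `LevelRegular` incl. (R0) ∧ Hölder ∧ periodic ∧ weakly div-free) from the eleven qualitative
per-level / per-flow clauses delivered by `stub_flowsL` + the bookkeeping clauses (S), N²-separation, θ-template (T4), amplitude decay DEC: the distortion
tower (advisory R23-2: uniform flow distortion, level sup / Lipschitz bounds) ⇒ (R0) pointwise (indeed normal) summability, Hölder summation of the levels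
(exponents `α < α₀`), time-periodicity of the sum (W1/W2 + commensurability), weak div-freeness of the `tsum` (dominated convergence). -/
theorem stub_regularL : ∀ k (W : Literature.Analysis.FluidPDE.LatticeShear.LatticeWord k), ∃ θs : ℝ, 0 < θs ∧ ∀ (E : Literature.Analysis.FluidPDE.LatticeShear.LagrangianLatticeCarrier k) (θ₀ : ℝ), E.design = W → θ₀ ≤ θs → E.toFractalCarrierData.Permissible → E.IsLagrangian → (∀ m, Continuous (Function.uncurry (E.b (m + 1)))) → (∀ m t, Literature.Analysis.FunctionSpaces.Torus.IsWeaklyDivFree (E.b (m + 1) t)) → (∀ m t, Literature.Analysis.FunctionSpaces.Torus.IsSmooth (E.b (m + 1) t)) → (∀ m (n : ℕ), ∃ C : ℝ, ∀ t y, ‖iteratedFDeriv ℝ n (Literature.Analysis.FunctionSpaces.Torus.lift (E.b (m + 1) t)) y‖ ≤ C) → (∀ m, ∃ τ : ℝ, 0 < τ ∧ Function.Periodic (E.b (m + 1)) τ) → (∀ m s, Continuous fun p : ℝ × UnitAddTorus (Fin 3) => E.disp m p.1 s p.2) → (∀ m t s, Literature.Analysis.FunctionSpaces.Torus.IsSmooth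 (E.disp m t s)) → (∀ m (n : ℕ) (j : ℤ), ∃ C : ℝ, ∀ t ∈ E.window (m + 1) j, ∀ y, ‖iteratedFDeriv ℝ n (Literature.Analysis.FunctionSpaces.Torus.lift (E.disp m t ((j : ℝ) * E.refresh (m + 1)))) y‖ ≤ C) → (∀ m s, E.X m s s = id) → (∀ m t s r, E.X m t s ∘ E.X m s r = E.X m t r) → (∀ m t s, MeasureTheory.MeasurePreserving (E.X m t s) MeasureTheory.volume MeasureTheory.volume) → (∀ m, ∃ r : ℕ, 0 < r ∧ E.refresh (m + 1) = (r : ℝ) * E.toFractalCarrierData.physPeriod (m + 1)) → (∀ m, ∃ q : ℕ, 0 < q ∧ E.refresh m = (q : ℝ) * E.refresh (m + 1)) → (∀ m, E.strain m ≤ E.θ (m + 1)) → (∀ m, E.N m ^ 2 ≤ E.N (m + 1)) → (∀ m, E.θ (m + 1) * ((E.N (m + 1) : ℝ) / E.N m) ^ (1 / 16 : ℝ) ≤ θ₀) → (∃ α₀ : ℝ, 0 < α₀ ∧ ∀ m, E.a (m + 1) ≤ ((E.N (m + 1) : ℝ)) ^ (1 - α₀)) → E.Regular := by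
  sorry

/-- The composition in hypothesis form: bookkeeping → flows → regularity → K3L (kernel-checked glue). -/
theorem LagrangianCarrierConstruction_of_hyps
    (h₁ : ∀ k (W : Literature.Analysis.FluidPDE.LatticeShear.LatticeWord k) (c ν₀ K θ₀ : ℝ) (Λ₀ : ℕ), 0 < c → 0 < ν₀ → 0 < K → 0 < θ₀ → ∃ E : Literature.Analysis.FluidPDE.LatticeShear.LagrangianLatticeCarrier k, E.design = W ∧ E.gain = c ∧ E.nu0 = ν₀ ∧ E.K = K ∧ E.toFractalCarrierData.Permissible ∧ (∀ m, ∃ r : ℕ, 0 < r ∧ E.refresh (m + 1) = (r : ℝ) * E.toFractalCarrierData.physPeriod (m + 1)) ∧ (∀ m, ∃ q : ℕ, 0 < q ∧ E.refresh m = (q : ℝ) * E.refresh (m + 1)) ∧ (∀ m, E.strain m ≤ E.θ (m + 1)) ∧ (∀ m, Λ₀ * E.N m ≤ E.N (m + 1)) ∧ (∀ m, E.N m ^ 2 ≤ E.N (m + 1)) ∧ (∀ m, E.cellVisc (m + 1) * ((E.N (m + 1) : ℝ) / E.N m) ^ (1 / 4 : ℝ) ≤ 1) ∧ (∀ m, E.K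 * ((E.N (m + 1) : ℝ) / E.N m) ^ (1 / 4 : ℝ) ≤ ((E.N (m + 1) : ℝ) / E.N m) * E.cellVisc (m + 1)) ∧ (∀ m, E.θ (m + 1) * ((E.N (m + 1) : ℝ) / E.N m) ^ (1 / 16 : ℝ) ≤ θ₀) ∧ (∀ m, ((E.N (m + 1) : ℝ) / E.N m) ^ (1 / 16 : ℝ) * E.physPeriod (m + 1) ≤ E.refresh (m + 1)) ∧ (∃ α₀ : ℝ, 0 < α₀ ∧ ∀ m, E.a (m + 1) ≤ ((E.N (m + 1) : ℝ)) ^ (1 - α₀)))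
    (h₂ : ∀ k (E : Literature.Analysis.FluidPDE.LatticeShear.LagrangianLatticeCarrier k), E.toFractalCarrierData.Permissible → (∀ m, ∃ r : ℕ, 0 < r ∧ E.refresh (m + 1) = (r : ℝ) * E.toFractalCarrierData.physPeriod (m + 1)) → (∀ m, ∃ q : ℕ, 0 < q ∧ E.refresh m = (q : ℝ) * E.refresh (m + 1)) → ∃ E' : Literature.Analysis.FluidPDE.LatticeShear.LagrangianLatticeCarrier k, E'.toFractalCarrierData = E.toFractalCarrierData ∧ E'.refresh = E.refresh ∧ E'.θ = E.θ ∧ E'.IsLagrangian ∧ (∀ m, Continuous (Function.uncurry (E'.b (m + 1)))) ∧ (∀ m t, Literature.Analysis.FunctionSpaces.Torus.IsWeaklyDivFree (E'.b (m + 1) t)) ∧ (∀ m t, Literature.Analysis.FunctionSpaces.Torus.IsSmooth (E'.b (m + 1) t)) ∧ (∀ m (n : ℕ), ∃ C : ℝ, ∀ t y, ‖iteratedFDeriv ℝ n (Literature.Analysis.FunctionSpaces.Torus.lift (E'.b (m + 1) t)) y‖ ≤ C) ∧ (∀ m, ∃ τ : ℝ, 0 < τ ∧ Function.Periodic (E'.b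 (m + 1)) τ) ∧ (∀ m s, Continuous fun p : ℝ × UnitAddTorus (Fin 3) => E'.disp m p.1 s p.2) ∧ (∀ m t s, Literature.Analysis.FunctionSpaces.Torus.IsSmooth (E'.disp m t s)) ∧ (∀ m (n : ℕ) (j : ℤ), ∃ C : ℝ, ∀ t ∈ E'.window (m + 1) j, ∀ y, ‖iteratedFDeriv ℝ n (Literature.Analysis.FunctionSpaces.Torus.lift (E'.disp m t ((j : ℝ) * E'.refresh (m + 1)))) y‖ ≤ C) ∧ (∀ m s, E'.X m s s = id) ∧ (∀ m t s r, E'.X m t s ∘ E'.X m s r = E'.X m t r) ∧ (∀ m t s, MeasureTheory.MeasurePreserving (E'.X m t s) MeasureTheory.volume MeasureTheory.volume))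
    (h₃ : ∀ k (W : Literature.Analysis.FluidPDE.LatticeShear.LatticeWord k), ∃ θs : ℝ, 0 < θs ∧ ∀ (E : Literature.Analysis.FluidPDE.LatticeShear.LagrangianLatticeCarrier k) (θ₀ : ℝ), E.design = W → θ₀ ≤ θs → E.toFractalCarrierData.Permissible → E.IsLagrangian → (∀ m, Continuous (Function.uncurry (E.b (m + 1)))) → (∀ m t, Literature.Analysis.FunctionSpaces.Torus.IsWeaklyDivFree (E.b (m + 1) t)) → (∀ m t, Literature.Analysis.FunctionSpaces.Torus.IsSmooth (E.b (m + 1) t)) → (∀ m (n : ℕ), ∃ C : ℝ, ∀ t y, ‖iteratedFDeriv ℝ n (Literature.Analysis.FunctionSpaces.Torus.lift (E.b (m + 1) t)) y‖ ≤ C) → (∀ m, ∃ τ : ℝ, 0 < τ ∧ Function.Periodic (E.b (m + 1)) τ) → (∀ m s, Continuous fun p : ℝ × UnitAddTorus (Fin 3) => E.disp m p.1 s p.2) → (∀ m t s, Literature.Analysis.FunctionSpaces.Torus.IsSmooth (E.disp m t s)) → (∀ m (n : ℕ) (j : ℤ), ∃ C : ℝ, ∀ t ∈ E.window (m + 1)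 j, ∀ y, ‖iteratedFDeriv ℝ n (Literature.Analysis.FunctionSpaces.Torus.lift (E.disp m t ((j : ℝ) * E.refresh (m + 1)))) y‖ ≤ C) → (∀ m s, E.X m s s = id) → (∀ m t s r, E.X m t s ∘ E.X m s r = E.X m t r) → (∀ m t s, MeasureTheory.MeasurePreserving (E.X m t s) MeasureTheory.volume MeasureTheory.volume) → (∀ m, ∃ r : ℕ, 0 < r ∧ E.refresh (m + 1) = (r : ℝ) * E.toFractalCarrierData.physPeriod (m + 1)) → (∀ m, ∃ q : ℕ, 0 < q ∧ E.refresh m = (q : ℝ) * E.refresh (m + 1)) → (∀ m, E.strain m ≤ E.θ (m + 1)) → (∀ m, E.N m ^ 2 ≤ E.N (m + 1)) → (∀ m, E.θ (m + 1) * ((E.N (m + 1) : ℝ) / E.N m) ^ (1 / 16 : ℝ) ≤ θ₀) → (∃ α₀ : ℝ, 0 < α₀ ∧ ∀ m, E.a (m + 1) ≤ ((E.N (m + 1) : ℝ)) ^ (1 - α₀)) → E.Regular) :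
    LagrangianCarrierConstruction := by
  intro k W c ν₀ K θ₀ Λ₀ hc hν₀ hK hθ₀
  -- v8: the regularity stub fixes a strain-budget ceiling `θs = θs(k, W) > 0`; the bookkeeping is built for `min θ₀ θs`
  -- (its template clause (T4) is monotone in `θ₀`, so the crux's clause for `θ₀` and the stub's for `θs` both follow).
  obtain ⟨θs, hθs, h₃'⟩ := h₃ k W
  obtain ⟨E, hD, hg, hn, hKK, hP, hW1, hW2, hS, t1a, t1b, t2, t3, t4, t5, hdec⟩ :=
    h₁ k W c ν₀ K (min θ₀ θs) Λ₀ hc hν₀ hK (lt_min hθ₀ hθs)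
  obtain ⟨E', hF, hr, hθ, hLag, l1, l2, l3a, l3b, l4, f1a, f1b, f1c, f2a, f2b, f2c⟩ := h₂ k E hP hW1 hW2
  obtain ⟨F', refresh', θ', b', disp', hrp', hθp'⟩ := E'
  obtain ⟨F, refresh, θ, b, disp, hrp, hθp⟩ := E
  simp only at hF hr hθ
  subst hF hr hθ
  -- the witness is E' (fields b', disp'); every bookkeeping clause of E transports by definitional unfolding of the projections
  refine ⟨⟨F', refresh', θ', b', disp', hrp', hθp'⟩, hD, hg, hn, hKK,
    Literature.Analysis.FluidPDE.LatticeShear.LagrangianLatticeCarrier.LPermissible.intro hP hLag hW1 hW2 hS hdec,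
    h₃' ⟨F', refresh', θ', b', disp', hrp', hθp'⟩ (min θ₀ θs) hD (min_le_right _ _) hP hLag l1 l2 l3a l3b l4 f1a f1b f1c f2a f2b f2c hW1 hW2 hS t1b t4 hdec, t1a, t1b, t2, t3,
    fun m => (t4 m).trans (min_le_left _ _), t5⟩

/-- The registered composition (closed form, D-0019 skeleton shape): K3L from the three named stubs. -/
theorem LagrangianCarrierConstruction_of : LagrangianCarrierConstruction :=
  LagrangianCarrierConstruction_of_hyps stub_bookkeepingL stub_flowsL stub_regularL

end Summit.AnomalousDissipation.AnomalousDissipation.Cruxes.LagrangianCarrierConstruction.BirthV8Candidate
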